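import Summits.QuantumFields.QCD.Theorems.QuarksAsStableActionStableActionBridgeSliceKernelInvariance
import Summits.QuantumFields.QCD.Theorems.QuarksAsStableActionStableActionBridgeTransferPositivity
import Literature.MathematicalPhysics.QuantumFieldTheory.ConstructiveQFTWave0Proofs

/-!
# The Gauss-projected pure-gauge transfer map preserves the form core
(crux `QuarksAsStableAction.StableActionBridge`, item stmt-QuantumFields-9737, line `Sketch`;
registered stub `gaugeKernel_integral_mem_transferCore`)

Smit, *Introduction to Quantum Fields on a Lattice*, §4.6 (4.121)–(4.137): in temporal gauge the
pure-gauge transfer operator of Wilson's `SU(3)` lattice gauge theory on the spatial three-torus acts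
on wave functions `χ(U)` of the slice link variables by the integral operator
`(T̂_U χ)(U) = ∫ K_β(U, U') χ(U') dU'` with the continuous, strictly positive kernel
`K_β = gaugeSliceKernel β` (Smit (4.121), (4.129); Lüscher, CMP 54 (1977) 283–292) and the product
Haar measure `dU' = sliceHaar S` (Smit (4.117)–(4.118)).  It commutes with time-independent gauge
transformations (Smit (4.124)–(4.127)), hence with the Gauss-law projector `P̂₀` (4.130)–(4.137).

In the tree's operator-free rendering (`Literature/…/QCDTransferMatrix.lean`) the physical states are
the FORM CORE `transferCore Nf S = {Ψ | Continuous Ψ ∧ IsGaugeInvariantWave Ψ}` of continuous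
Fock-vector-valued wave functions obeying the Gauss law `Ψ(U^g) = Γ(G_g) Ψ(U)`.  This file proves
that `T̂_U` (tensored with the identity on the quark Fock space) maps the core to itself:

* continuity of `U ↦ ∫ K_β(U, U') • χ(U') dU'` — a parametric Bochner integral of a jointly
  continuous integrand (`continuous_gaugeSliceKernel`, p126750) over the compact configuration space
  with the finite measure `sliceHaar` (Mathlib's `continuous_parametric_integral_of_continuous`);
* gauge invariance — substitute `U' = U''^g` (the product Haar measure is gauge invariant,
  `WilsonGauge.measurePreserving_gaugeTransform`), use `K_β(U^g, U''^g) = K_β(U, U'')`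
  (`gaugeSliceKernel_gaugeTransform`, p128356) and the Gauss law of `χ`, and pull the constant
  matrix `Γ(G_g) = fockGaugeAct g` out of the Bochner integral
  (`ContinuousLinearMap.integral_comp_comm`).

Pure theorem file (no definitions).

[cite: Smit2023, §4.6 (4.121)–(4.137)] [cite: Luscher1977, pp. 283–292]
-/

noncomputable section

namespace Summit.QuantumFields.QCD.Cruxes.StableActionBridge.Sketch

open MeasureTheory Matrix Literature.MathematicalPhysics.QuantumFieldTheory
  Literature.MathematicalPhysics.QuantumLattice
open Literature.Probability.LatticeModels (TorusSite)

namespace CoreGaugeStep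

/-- **Continuity of parametric integrals over the slice**: for a jointly continuous integrand
`f : SU(3)^E × SU(3)^E → E` the Haar integral `U ↦ ∫ f(U, U') dU'` is continuous in `U` (compact
configuration space, finite measure; Mathlib's `continuous_parametric_integral_of_continuous` on
`s = univ`). [folklore] -/
theorem continuous_integral_sliceHaar {S : ℕ} [NeZero S] {E : Type*} [NormedAddCommGroup E]
    [NormedSpace ℝ E]
    {f : GaugeConfig 3 S (Matrix.specialUnitaryGroup (Fin 3) ℂ) →
      GaugeConfig 3 S (Matrix.specialUnitaryGroup (Fin 3) ℂ) → E}
    (hf : Continuous (Function.uncurry f)) :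
    Continuous fun U => ∫ U', f U U' ∂(sliceHaar S) := by
  haveI := isProbabilityMeasure_sliceHaar S
  have h := continuous_parametric_integral_of_continuous (μ := sliceHaar S) hf isCompact_univ
  simpa only [Measure.restrict_univ] using h

/-- A continuous function on the (compact) slice configuration space with values in a normed
space is integrable for the product Haar probability measure. [folklore] -/
theorem integrable_sliceHaar_of_continuous' {S : ℕ} [NeZero S] {E : Type} [NormedAddCommGroup E]
    {f : GaugeConfig 3 S (Matrix.specialUnitaryGroup (Fin 3) ℂ) → E} (hf : Continuous f) :
    Integrable f (sliceHaar S) := by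
  haveI := isProbabilityMeasure_sliceHaar S
  obtain ⟨C, hC⟩ := exists_bound_of_continuous_slice hf
  exact (integrable_const C).mono' hf.aestronglyMeasurable (Filter.Eventually.of_forall hC)

/-- **Gauge transformations preserve the slice Haar measure** `sliceHaar S = ∏ₗ dU_l`
(`WilsonGauge.measurePreserving_gaugeTransform`: link by link a two-sided Haar translation).
[folklore] -/
theorem measurePreserving_gaugeTransform_sliceHaar {S : ℕ} [NeZero S]
    (g : TorusSite 3 S → Matrix.specialUnitaryGroup (Fin 3) ℂ) :
    MeasurePreserving (gaugeTransform g) (sliceHaar S) (sliceHaar S) :=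
  WilsonGauge.measurePreserving_gaugeTransform g

/-- **Change of variables `U ↦ U^g` in slice Haar integrals**: for continuous `F`,
`∫ F(U^g) dU = ∫ F(U) dU`. [folklore] -/
theorem integral_comp_gaugeTransform {S : ℕ} [NeZero S] {E : Type} [NormedAddCommGroup E]
    [NormedSpace ℝ E] (g : TorusSite 3 S → Matrix.specialUnitaryGroup (Fin 3) ℂ)
    {F : GaugeConfig 3 S (Matrix.specialUnitaryGroup (Fin 3) ℂ) → E} (hF : Continuous F) :
    ∫ U, F (gaugeTransform g U) ∂(sliceHaar S) = ∫ U, F U ∂(sliceHaar S) := by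
  have hmp := measurePreserving_gaugeTransform_sliceHaar g
  conv_rhs => rw [← hmp.map_eq]
  rw [integral_map hmp.measurable.aemeasurable hF.aestronglyMeasurable]

/-- **A constant matrix commutes with the Bochner integral**: `∫ M (G U) dU = M ∫ G(U) dU` for an
integrable vector-valued `G` (`Matrix.mulVec M` is a continuous linear map on the finite-dimensional
space `n → ℂ`). [folklore] -/
theorem integral_mulVec_comm {S : ℕ} [NeZero S] {m n : Type} [Fintype m] [Fintype n]
    [DecidableEq n] (M : Matrix m n ℂ)
    {G : GaugeConfig 3 S (Matrix.specialUnitaryGroup (Fin 3) ℂ) → n → ℂ}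
    (hG : Integrable G (sliceHaar S)) :
    ∫ U, M *ᵥ G U ∂(sliceHaar S) = M *ᵥ ∫ U, G U ∂(sliceHaar S) := by
  have h := ContinuousLinearMap.integral_comp_comm
    (LinearMap.toContinuousLinearMap (Matrix.mulVecLin M)) hG
  simpa only [LinearMap.coe_toContinuousLinearMap', Matrix.mulVecLin_apply] using h

end CoreGaugeStep

open CoreGaugeStep

/-- **The Gauss-projected gauge transfer map preserves the form core** (registered sub-goal
`gaugeKernel_integral_mem_transferCore`; Smit §4.6 (4.121)–(4.137)): for every `β` and every
continuous gauge-invariant wave function `χ ∈ transferCore`, the wave function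
`U ↦ ∫ K_β(U, U') • χ(U') dU'` is again continuous (parametric integral of a jointly continuous
integrand over the compact slice) and gauge invariant (`K_β(U^g, U'^g) = K_β(U, U')`, Haar measure
gauge invariant, `Γ(G_g)` constant pulled out of the integral).
[cite: Smit2023, §4.6 (4.121)–(4.137)] [cite: Luscher1977, pp. 283–292] -/
theorem gaugeKernel_integral_mem_transferCore : ∀ (Nf S : ℕ) [NeZero S] (β : ℝ) (χ : SliceWave Nf S), χ ∈ transferCore Nf S → (fun U : GaugeConfig 3 S (Matrix.specialUnitaryGroup (Fin 3) ℂ) => ∫ U', ((gaugeSliceKernel β U U' : ℝ) : ℂ) • χ U' ∂(sliceHaar S)) ∈ transferCore Nf S := by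
  intro Nf S _ β χ hχ
  obtain ⟨hcont, hinv⟩ := hχ
  -- the integrand `(U, U') ↦ K_β(U, U') • χ(U')` is jointly continuous
  have hF : Continuous (Function.uncurry
      fun (U U' : GaugeConfig 3 S (Matrix.specialUnitaryGroup (Fin 3) ℂ)) =>
        ((gaugeSliceKernel β U U' : ℝ) : ℂ) • χ U') :=
    (Complex.continuous_ofReal.comp (continuous_gaugeSliceKernel S β)).smul (hcont.comp continuous_snd)
  refine ⟨continuous_integral_sliceHaar hF, fun g U => ?_⟩
  dsimp only
  -- the sections `U' ↦ K_β(U^g, U') • χ(U')`, `U' ↦ K_β(U, U') • χ(U')` are continuous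
  have hsec : Continuous fun U' : GaugeConfig 3 S (Matrix.specialUnitaryGroup (Fin 3) ℂ) =>
      ((gaugeSliceKernel β (gaugeTransform g U) U' : ℝ) : ℂ) • χ U' :=
    hF.uncurry_left (gaugeTransform g U)
  have hsecU : Continuous fun U' : GaugeConfig 3 S (Matrix.specialUnitaryGroup (Fin 3) ℂ) =>
      ((gaugeSliceKernel β U U' : ℝ) : ℂ) • χ U' :=
    hF.uncurry_left U
  calc ∫ U', ((gaugeSliceKernel β (gaugeTransform g U) U' : ℝ) : ℂ) • χ U' ∂(sliceHaar S)
      = ∫ U', ((gaugeSliceKernel β (gaugeTransform g U) (gaugeTransform g U') : ℝ) : ℂ) •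
          χ (gaugeTransform g U') ∂(sliceHaar S) := (integral_comp_gaugeTransform g hsec).symm
    _ = ∫ U', fockGaugeAct g *ᵥ (((gaugeSliceKernel β U U' : ℝ) : ℂ) • χ U') ∂(sliceHaar S) := by
        congr 1
        funext U'
        rw [gaugeSliceKernel_gaugeTransform, hinv g U', Matrix.mulVec_smul]
    _ = fockGaugeAct g *ᵥ ∫ U', ((gaugeSliceKernel β U U' : ℝ) : ℂ) • χ U' ∂(sliceHaar S) :=
        integral_mulVec_comm _ (integrable_sliceHaar_of_continuous' hsecU)

end Summit.QuantumFields.QCD.Cruxes.StableActionBridge.Sketch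

end
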